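import Summits.CriticalPhenomena.PercolationContinuityZ3.Theorems.PercNearOneGluingNoHeavyLowerTailSahiCombPositivity
import Summits.CriticalPhenomena.PercolationContinuityZ3.Theorems.SahiMasterFamilyMinors

/-!
# The comb (tensor-Bernstein) hierarchy for Sahi's `E_k`, II: the master statement (M⁺-k) typed for every `k`;
# (M⁺-k) ⇒ (M-k); (M⁺-k) ⇒ density-free zeros; (M⁺-2) PROVED by the law of total covariance

Support file of the one-cut programme (crux `NoHeavyLowerTail`, stmt-CriticalPhenomena-4575; cell `prim-masterthm`, seat P3;
`run/shared/lean/prim/prim-masterthm/prim-masterthm-p3/HIERARCHY.md` §1–§3, `run/shared/lean/prim/MASTER-FAMILY.md` §MASTER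
"(M⁺-k) COEFFICIENTWISE variant (strictly stronger; not in Lean)" — now in Lean).

* `MasterFamilyCombPos k` — **(M⁺-k)**: for every finite `ι` and every `k` increasing events `U_j ⊆ 2^ι`, the function
  `p ↦ E_k(μ_p; 1_{U_0},…,1_{U_{k−1}})` on `[0,1]^ι` is COMB-POSITIVE at multidegree `k` (a nonnegative combination of
  `∏_e p_e^{j_e}(1−p_e)^{k−j_e}`, `j ≤ k`; = "all degree-`k` tensor-Bernstein coefficients — the `k`-copy fibre sums of
  HIERARCHY §1 — are `≥ 0`").  `@[conjecture]`: OPEN for `k ≥ 3` (exhaustive integer censuses: `k = 3` on `m ≤ 5`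
  coordinates, `k = 4` on `m ≤ 4`, `k = 5` on `m ≤ 4`, `k = 6, 7` on `m = 3`; graph dictionaries; `0` negative
  coefficients — HIERARCHY §4); never import it as a fact.
* `masterFamilyCombPos_le_masterFamilyNonneg` — (M⁺-k) ⇒ (M-k) (= `MasterFamilyNonneg k`, Sahi's `C_k` on product measures).
* `sahiE_ind_eq_zero_of_interior_zero` — (M⁺-k) ⇒ (EQ⁰-k): a zero of `E_k` at ONE interior `p` forces `E_k ≡ 0` on the cube.
* `masterFamilyCombPos_zero`, `masterFamilyCombPos_one`, and **`masterFamilyCombPos_two` — (M⁺-2) is a THEOREM**: the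
  covariance of two increasing events is comb-positive at multidegree `2` on every finite cube.  Proof = the law of total
  covariance iterated over the coordinates: peeling `e`,
  `Cov(U,V) = (1−p_e)²·Cov(U⁰,V⁰) + p_e²·Cov(U¹,V¹) + p_e(1−p_e)·[Cov(U⁰,V⁰) + Cov(U¹,V¹) + (μU¹ − μU⁰)(μV¹ − μV⁰)]`
  (`U^b` the `e`-sections, `U⁰ ⊆ U¹`), every bracket comb-positive by induction and `CombPos.mul` — the degree-2
  Bernstein coefficients in `p_e` are manifestly nonnegative although the individual two-copy "colouring" terms are not
  (HIERARCHY §3, remark on coordinate induction).  This is the tree's second proof of the `k = 2` row after the counting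
  form `TwoPartition.twoPartN_nonneg` (Harris–Kleitman twice); it needs no counting.
Everything except the tagged conjecture is proved; axioms standard. [this work]
-/

noncomputable section

open scoped Classical

namespace Summit.CriticalPhenomena.PercolationContinuityZ3.Theorems

open Finset Function
open Literature.Combinatorics.Sahi2008
open Literature.Probability.Percolation (DeterminedBy determinedBy_iff)
open Literature.Probability.Percolation.DecisionTree (ind ind_of_mem ind_of_not_mem ind_nonneg)
open SahiComb

/-! ### (M⁺-k) -/

/-- **(M⁺-k) — comb (tensor-Bernstein) positivity of Sahi's `E_k` on product measures** (this work / MASTER-FAMILY.md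
§MASTER; HIERARCHY.md §3): for every finite `ι` and all increasing `U_0,…,U_{k−1} ⊆ 2^ι`, `p ↦ E_k(μ_p; 1_U)` is a
nonnegative combination of the degree-`k` tensor-Bernstein basis on `[0,1]^ι`.  THEOREM for `k ≤ 2`
(`masterFamilyCombPos_two`); OPEN for `k ≥ 3` (census-clean on every exhaustive cell, HIERARCHY §4).  Strictly stronger
than `MasterFamilyNonneg k` (`masterFamilyCombPos_le_masterFamilyNonneg`).  An obligation of our theories, never a fact:
use as `(h : MasterFamilyCombPos k)`. [status: open for k ≥ 3] -/
@[conjecture] def MasterFamilyCombPos (k : ℕ) : Prop :=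
  ∀ (ι : Type) [Fintype ι] (U : Fin k → Set (Set ι)), (∀ j, IsUpperSet (U j)) →
    CombPos (fun _ : ι => k) (fun p => sahiE (bernoulliWeight p) k (fun j => ind (U j)))

/-- **(M⁺-k) ⇒ (M-k)**: comb positivity gives Sahi's `C_k` for every product measure. [this work] -/
theorem masterFamilyCombPos_le_masterFamilyNonneg (k : ℕ) : MasterFamilyCombPos k → MasterFamilyNonneg k :=
  fun h ι _ p U hU => (h ι U hU).nonneg p

/-- **(M⁺-k) ⇒ (EQ⁰-k), density-free zero sets**: under (M⁺-k), if `E_k(μ_q; 1_U) = 0` at one point `q` of the OPEN cube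
then `E_k(μ_p; 1_U) = 0` for every `p ∈ [0,1]^ι`. [this work] -/
theorem sahiE_ind_eq_zero_of_interior_zero {k : ℕ} (h : MasterFamilyCombPos k) {ι : Type} [Fintype ι]
    {U : Fin k → Set (Set ι)} (hU : ∀ j, IsUpperSet (U j)) {q : ι → unitInterval}
    (hq : ∀ e, (q e : ℝ) ∈ Set.Ioo (0 : ℝ) 1) (h0 : sahiE (bernoulliWeight q) k (fun j => ind (U j)) = 0)
    (p : ι → unitInterval) : sahiE (bernoulliWeight p) k (fun j => ind (U j)) = 0 :=
  (h ι U hU).eq_zero_of_interior hq h0 p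

/-- (M⁺-0): `E_0 = 0`. [this work] -/
theorem masterFamilyCombPos_zero : MasterFamilyCombPos 0 :=
  fun _ _ _ _ => (CombPos.zero _).congr fun _ => sahiE_zero _ _

/-- (M⁺-1): `E_1(1_U) = μ_p(U)` is a nonnegative combination of the degree-1 basis (`combPos_ex`). [this work] -/
theorem masterFamilyCombPos_one : MasterFamilyCombPos 1 :=
  fun _ _ U _ => (combPos_ex_ind (U 0)).congr fun _ => sahiE_one_apply _ _

/-! ### One-coordinate sections under the product weight -/

section Sections

variable {ι : Type*} [Fintype ι]

/-- The section moments of `…CommonPivotal` are the probabilities of the sections. [this work] -/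
theorem secEx_ind_eq (p : ι → unitInterval) (e : ι) (X : Set (Set ι)) (b : Bool) :
    secEx p e (ind X) b = ex (bernoulliWeight p) (ind (secAt e b X)) := by
  have h1 : ex (bernoulliWeight (update p e (boolParam b))) (ind X) = secEx p e (ind X) b := by
    rw [ex_update_eq]; cases b <;> simp [boolParam]
  rw [← h1, ex_ind_update_boolParam, ex_update_eq_of_ignores p e (boolParam b) (p e) (ind_secAt_insert e b X),
    update_eq_self]

/-- **Conditioning on one coordinate**: `μ_p(X) = p_e·μ_p(X^{e←1}) + (1 − p_e)·μ_p(X^{e←0})`. [folklore] -/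
theorem ex_ind_eq_secAt (p : ι → unitInterval) (e : ι) (X : Set (Set ι)) :
    ex (bernoulliWeight p) (ind X) =
      (p e : ℝ) * ex (bernoulliWeight p) (ind (secAt e true X)) +
        (1 - (p e : ℝ)) * ex (bernoulliWeight p) (ind (secAt e false X)) := by
  have h0 := ex_update_eq p e (p e) (ind X)
  rw [update_eq_self] at h0
  rw [h0, secEx_ind_eq, secEx_ind_eq]

/-- Probabilities of sections do not depend on `p_e`. [folklore] -/
theorem ex_ind_secAt_update (p : ι → unitInterval) (e : ι) (b : Bool) (X : Set (Set ι)) (s : unitInterval) :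
    ex (bernoulliWeight (update p e s)) (ind (secAt e b X)) = ex (bernoulliWeight p) (ind (secAt e b X)) := by
  have h := ex_update_eq_of_ignores p e s (p e) (ind_secAt_insert e b X)
  rwa [update_eq_self] at h

omit [Fintype ι] in
/-- The two sections of an increasing event are nested: `U^{e←0} ⊆ U^{e←1}` (local copy of the tree's
`secAt_false_subset_true` of `SahiMasterFamilyTrichotomy`, kept private to keep the imports light). [folklore] -/
private theorem secAt_false_le_true (e : ι) {U : Set (Set ι)} (hU : IsUpperSet U) : secAt e false U ⊆ secAt e true U := by
  intro ω hω
  rw [mem_secAt] at hω ⊢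
  simp only [forceAt, cond_false, cond_true] at hω ⊢
  exact hU (subset_trans (fun x hx => hx.1) (Set.subset_insert e ω)) hω

omit [Fintype ι] in
/-- An event determined by no coordinate is trivial. [folklore] -/
theorem eq_empty_or_univ_of_determinedBy_empty {A : Set (Set ι)} (hA : DeterminedBy A (↑(∅ : Finset ι) : Set ι)) :
    A = ∅ ∨ A = Set.univ := by
  rw [determinedBy_iff] at hA
  by_cases h : (∅ : Set ι) ∈ A
  · right; ext ω
    simp only [Set.mem_univ, iff_true]
    exact (hA ∅ ω (by simp)).1 h
  · left; ext ω
    simp only [Set.mem_empty_iff_false, iff_false]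
    exact fun hω => h ((hA ω ∅ (by simp)).1 hω)

omit [Fintype ι] in
/-- Restricting the multidegree at one coordinate and putting it back. [folklore] -/
theorem update_zero_add_single (c : ι → ℕ) (e : ι) : update c e 0 + Pi.single e (c e) = c := by
  funext e'
  by_cases he : e' = e
  · subst he; simp
  · simp [he]

end Sections

/-! ### Freezing a set of coordinates to `1`: set-sections and the push-forward identity -/

section Freeze

variable {ι : Type*} [Fintype ι]

omit [Fintype ι] in
/-- The set-section `X^{S←1} = {ω | ω ∪ S ∈ X}` (all coordinates of `S` forced to `1`). [folklore] -/
def secUnion (S : Set ι) (X : Set (Set ι)) : Set (Set ι) := {ω | ω ∪ S ∈ X}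

omit [Fintype ι] in
/-- Membership in a set-section. [folklore] -/
theorem mem_secUnion {S : Set ι} {X : Set (Set ι)} {ω : Set ι} : ω ∈ secUnion S X ↔ ω ∪ S ∈ X := Iff.rfl

omit [Fintype ι] in
/-- Set-sections of increasing events are increasing. [folklore] -/
theorem isUpperSet_secUnion (S : Set ι) {X : Set (Set ι)} (hX : IsUpperSet X) : IsUpperSet (secUnion S X) :=
  fun _ _ hle hω => hX (Set.union_subset_union_left S hle) hω

omit [Fintype ι] in
/-- An increasing event lies inside its set-section. [folklore] -/
theorem subset_secUnion (S : Set ι) {X : Set (Set ι)} (hX : IsUpperSet X) : X ⊆ secUnion S X :=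
  fun _ hω => hX Set.subset_union_left hω

omit [Fintype ι] in
/-- Set-sections commute with intersections. [folklore] -/
theorem secUnion_inter (S : Set ι) (X Y : Set (Set ι)) : secUnion S (X ∩ Y) = secUnion S X ∩ secUnion S Y := rfl

/-- **One-coordinate push-forward**: the product weight with `p_e` set to `1` is the image of `μ_p` under `ω ↦ ω ∪ {e}`:
`E_{p[e↦1]}[h] = E_p[h(· ∪ {e})]`. [folklore] -/
theorem ex_bernoulliWeight_update_one (p : ι → unitInterval) (e : ι) (h : Set ι → ℝ) :
    ex (bernoulliWeight (update p e 1)) h = ex (bernoulliWeight p) (fun ω => h (insert e ω)) := by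
  have h1 := ex_update_eq p e 1 h
  have h2 := ex_update_eq p e (p e) (fun ω => h (insert e ω))
  rw [update_eq_self] at h2
  have h3 : ∀ b : Bool, secEx p e (fun ω => h (insert e ω)) b = secEx p e h true := by
    intro b
    simp only [secEx]
    refine sum_congr rfl fun ω _ => ?_
    cases b <;> simp
  rw [h1, h2, h3, h3]
  simp only [Set.Icc.coe_one]
  ring

/-- **Push-forward along freezing**: the product weight with the coordinates of `S` frozen to `1` is the image of `μ_p` under
`ω ↦ ω ∪ S`: `E_{p[S↦1]}[h] = E_p[h(· ∪ S)]`. [folklore] -/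
theorem ex_bernoulliWeight_freeze (p : ι → unitInterval) (S : Set ι) (h : Set ι → ℝ) :
    ex (bernoulliWeight fun e => if e ∈ S then 1 else p e) h = ex (bernoulliWeight p) (fun ω => h (ω ∪ S)) := by
  -- induction on a finset `T` with `S = ↑T`
  suffices key : ∀ (T : Finset ι) (h : Set ι → ℝ),
      ex (bernoulliWeight fun e => if e ∈ T then 1 else p e) h = ex (bernoulliWeight p) (fun ω => h (ω ∪ ↑T)) by
    have hS : (fun e => if e ∈ S then (1 : unitInterval) else p e) = fun e => if e ∈ S.toFinset then 1 else p e := by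
      funext e; simp only [Set.mem_toFinset]
    rw [hS, key S.toFinset h]
    simp only [Set.coe_toFinset]
  intro T
  induction T using Finset.induction_on with
  | empty => intro h; simp
  | insert a T haT ih =>
    intro h
    have hupd : (fun e => if e ∈ insert a T then (1 : unitInterval) else p e) =
        update (fun e => if e ∈ T then 1 else p e) a 1 := by
      funext e
      by_cases hea : e = a
      · subst hea; simp
      · rw [update_of_ne hea]; simp [hea]
    rw [hupd, ex_bernoulliWeight_update_one, ih]
    refine congrArg _ (funext fun ω => ?_)
    rw [Finset.coe_insert, Set.union_insert]

/-- **Frozen probabilities are probabilities of set-sections**: `P_{p[S↦1]}(X) = P_p(X^{S←1})`. [folklore] -/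
theorem ex_ind_freeze_eq_secUnion (p : ι → unitInterval) (S : Set ι) (X : Set (Set ι)) :
    ex (bernoulliWeight fun e => if e ∈ S then 1 else p e) (ind X) = ex (bernoulliWeight p) (ind (secUnion S X)) := by
  rw [ex_bernoulliWeight_freeze]
  refine congrArg _ (funext fun ω => ?_)
  by_cases hω : ω ∪ S ∈ X
  · rw [ind_of_mem hω, ind_of_mem (mem_secUnion.2 hω)]
  · rw [ind_of_not_mem hω, ind_of_not_mem fun h' => hω (mem_secUnion.1 h')]

/-- The conditional-minus-unconditional probability `P_p(X^{S←1}) − P_p(X) = P_p(X^{S←1} ∖ X)` of an increasing event is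
comb-positive at multidegree `1`. [this work] -/
theorem combPos_ex_secUnion_sub (S : Set ι) {X : Set (Set ι)} (hX : IsUpperSet X) :
    CombPos (fun _ : ι => 1)
      (fun p => ex (bernoulliWeight p) (ind (secUnion S X)) - ex (bernoulliWeight p) (ind X)) := by
  have hle : ∀ ω, ind X ω ≤ ind (secUnion S X) ω := fun ω => by
    by_cases h0 : ω ∈ X
    · rw [ind_of_mem h0, ind_of_mem (subset_secUnion S hX h0)]
    · rw [ind_of_not_mem h0]; exact ind_nonneg _ ω
  refine (combPos_ex (h := fun ω => ind (secUnion S X) ω - ind X ω) fun ω => sub_nonneg.2 (hle ω)).congr fun p => ?_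
  simp only [ex_def, mul_sub, sum_sub_distrib]

end Freeze

/-! ### (M⁺-2): the covariance of two increasing events is comb-positive at multidegree 2 -/

section Two

variable {ι : Type*} [Fintype ι]

/-- The covariance `μ_p(U ∩ V) − μ_p(U)μ_p(V)` as a function on the cube. [folklore] -/
def covFun (U V : Set (Set ι)) (p : ι → unitInterval) : ℝ :=
  ex (bernoulliWeight p) (ind (U ∩ V)) - ex (bernoulliWeight p) (ind U) * ex (bernoulliWeight p) (ind V)

/-- **Law of total covariance along one coordinate, in Bernstein form**: with `U^b, V^b` the `e`-sections,
`Cov(U,V) = (1−p_e)²·Cov(U⁰,V⁰) + p_e²·Cov(U¹,V¹) + p_e(1−p_e)·[Cov(U⁰,V⁰) + Cov(U¹,V¹) + (μU¹−μU⁰)(μV¹−μV⁰)]`. [folklore] -/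
theorem covFun_eq_secAt (U V : Set (Set ι)) (e : ι) (p : ι → unitInterval) :
    covFun U V p =
      (1 - (p e : ℝ)) ^ 2 * covFun (secAt e false U) (secAt e false V) p
      + (p e : ℝ) ^ 2 * covFun (secAt e true U) (secAt e true V) p
      + (p e : ℝ) * (1 - (p e : ℝ)) *
          (covFun (secAt e false U) (secAt e false V) p + covFun (secAt e true U) (secAt e true V) p
            + (ex (bernoulliWeight p) (ind (secAt e true U)) - ex (bernoulliWeight p) (ind (secAt e false U)))
              * (ex (bernoulliWeight p) (ind (secAt e true V)) - ex (bernoulliWeight p) (ind (secAt e false V)))) := by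
  simp only [covFun]
  rw [ex_ind_eq_secAt p e (U ∩ V), ex_ind_eq_secAt p e U, ex_ind_eq_secAt p e V, secAt_inter, secAt_inter]
  ring

/-- `Cov` of `e`-sections ignores `p_e`. [folklore] -/
theorem covFun_secAt_update (U V : Set (Set ι)) (e : ι) (b : Bool) (p : ι → unitInterval) (s : unitInterval) :
    covFun (secAt e b U) (secAt e b V) (update p e s) = covFun (secAt e b U) (secAt e b V) p := by
  simp only [covFun, ← secAt_inter, ex_ind_secAt_update]

/-- **(M⁺-2) on events determined by a given coordinate set** (induction on the set; the step is `covFun_eq_secAt`).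
[this work] -/
theorem combPos_covFun_of_determinedBy (S : Finset ι) :
    ∀ (U V : Set (Set ι)), IsUpperSet U → IsUpperSet V → DeterminedBy U (↑S : Set ι) → DeterminedBy V (↑S : Set ι) →
      CombPos (fun _ : ι => 2) (covFun U V) := by
  induction S using Finset.induction_on with
  | empty =>
    intro U V _ _ hUd hVd
    refine (CombPos.zero _).congr fun p => ?_
    -- an event determined by `∅` is `∅` or `univ`; either way the covariance vanishes
    have htriv : ∀ A : Set (Set ι), (A = ∅ ∨ A = Set.univ) →
        (ex (bernoulliWeight p) (ind A) = 0 ∧ ind A = 0) ∨ (ex (bernoulliWeight p) (ind A) = 1 ∧ ind A = 1) := by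
      rintro A (rfl | rfl)
      · left
        have h0 : ind (∅ : Set (Set ι)) = 0 := funext fun ω => ind_of_not_mem (Set.notMem_empty ω)
        refine ⟨?_, h0⟩
        rw [h0]; simp [ex_def]
      · right
        refine ⟨?_, ind_univ_eq_one⟩
        rw [ind_univ_eq_one]; exact ex_one (sum_bernoulliWeight p)
    simp only [covFun]
    have hUV : ind (U ∩ V) = ind U * ind V := funext fun ω =>
      Literature.Probability.Percolation.BHK2006.ind_inter U V ω
    rw [hUV]
    rcases htriv U (eq_empty_or_univ_of_determinedBy_empty hUd) with ⟨-, hU0'⟩ | ⟨-, hU1'⟩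
    · rw [hU0']; simp [ex_def]
    · rw [hU1', one_mul, ex_one (sum_bernoulliWeight p), one_mul, sub_self]
  | insert e S heS ih =>
    intro U V hU hV hUd hVd
    -- sections are increasing and determined by `S`
    have hsec : ∀ (b : Bool) (A : Set (Set ι)), IsUpperSet A → DeterminedBy A (↑(insert e S) : Set ι) →
        IsUpperSet (secAt e b A) ∧ DeterminedBy (secAt e b A) (↑S : Set ι) := fun b A hA hAd => by
      refine ⟨isUpperSet_secAt e b hA, ?_⟩
      have := determinedBy_secAt e b hAd
      rwa [erase_insert heS] at this
    have hcov : ∀ b : Bool, CombPos (update (fun _ : ι => 2) e 0) (covFun (secAt e b U) (secAt e b V)) := fun b =>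
      (ih _ _ (hsec b U hU hUd).1 (hsec b V hV hVd).1 (hsec b U hU hUd).2 (hsec b V hV hVd).2).of_ignores e
        fun p s => covFun_secAt_update U V e b p s
    -- the influence terms `μ(A¹) − μ(A⁰) = μ(A¹ ∖ A⁰)` are comb-positive of multidegree 1 and ignore `e`
    have hinfl : ∀ (A : Set (Set ι)), IsUpperSet A → CombPos (update (fun _ : ι => 1) e 0)
        (fun p => ex (bernoulliWeight p) (ind (secAt e true A)) - ex (bernoulliWeight p) (ind (secAt e false A))) := by
      intro A hA
      have hle : ∀ ω, ind (secAt e false A) ω ≤ ind (secAt e true A) ω := fun ω => by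
        by_cases h0 : ω ∈ secAt e false A
        · rw [ind_of_mem h0, ind_of_mem (secAt_false_le_true e hA h0)]
        · rw [ind_of_not_mem h0]; exact ind_nonneg _ ω
      have h1 : CombPos (fun _ : ι => 1)
          (fun p => ex (bernoulliWeight p) (ind (secAt e true A)) - ex (bernoulliWeight p) (ind (secAt e false A))) := by
        refine (combPos_ex (h := fun ω => ind (secAt e true A) ω - ind (secAt e false A) ω)
          fun ω => sub_nonneg.2 (hle ω)).congr fun p => ?_
        simp only [ex_def, mul_sub, sum_sub_distrib]
      exact h1.of_ignores e fun p s => by simp only [ex_ind_secAt_update]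
    -- one-coordinate weights
    have hw2 : CombPos (Pi.single e 2) (fun p : ι → unitInterval => (1 - (p e : ℝ)) ^ 2) :=
      (combPos_single e (Nat.zero_le 2)).congr fun p => by simp
    have hw0 : CombPos (Pi.single e 2) (fun p : ι → unitInterval => (p e : ℝ) ^ 2) :=
      (combPos_single e (le_refl 2)).congr fun p => by simp
    have hw1 : CombPos (Pi.single e 2) (fun p : ι → unitInterval => (p e : ℝ) * (1 - (p e : ℝ))) :=
      (combPos_single e (show 1 ≤ 2 by norm_num)).congr fun p => by simp
    have hdeg2 : Pi.single e 2 + update (fun _ : ι => 2) e 0 = fun _ => 2 := by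
      rw [add_comm]; exact update_zero_add_single (fun _ : ι => 2) e
    have hdeg1 : update (fun _ : ι => (1 : ℕ)) e 0 + update (fun _ : ι => 1) e 0 = update (fun _ : ι => 2) e 0 := by
      funext e'; by_cases he : e' = e
      · subst he; simp
      · simp [update_of_ne he]
    -- assemble
    have hbr : CombPos (update (fun _ : ι => 2) e 0)
        (fun p => covFun (secAt e false U) (secAt e false V) p + covFun (secAt e true U) (secAt e true V) p
          + (ex (bernoulliWeight p) (ind (secAt e true U)) - ex (bernoulliWeight p) (ind (secAt e false U)))
            * (ex (bernoulliWeight p) (ind (secAt e true V)) - ex (bernoulliWeight p) (ind (secAt e false V)))) :=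
      ((hcov false).add (hcov true)).add ((hinfl U hU).mul_of_eq (hinfl V hV) hdeg1)
    have htot := ((hw2.mul_of_eq (hcov false) hdeg2).add (hw0.mul_of_eq (hcov true) hdeg2)).add (hw1.mul_of_eq hbr hdeg2)
    refine htot.congr fun p => ?_
    rw [covFun_eq_secAt U V e p]

/-- **(M⁺-2)**: the covariance of two increasing events of a finite cube is comb-positive at multidegree `2`. [this work] -/
theorem combPos_covFun (U V : Set (Set ι)) (hU : IsUpperSet U) (hV : IsUpperSet V) :
    CombPos (fun _ : ι => 2) (covFun U V) :=
  combPos_covFun_of_determinedBy Finset.univ U V hU hV (determinedBy_coe_univ U) (determinedBy_coe_univ V)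

end Two

/-- **(M⁺-2) is a theorem**: the `k = 2` row of the comb hierarchy — `E_2(μ_p; 1_U, 1_V) = Cov` is a nonnegative combination
of the degree-2 tensor-Bernstein basis for all increasing `U, V` on every finite cube. [this work] -/
theorem masterFamilyCombPos_two : MasterFamilyCombPos 2 := by
  intro ι _ U hU
  refine (combPos_covFun (U 0) (U 1) (hU 0) (hU 1)).congr fun p => ?_
  rw [sahiE_two_apply, covFun]
  congr 2
  funext ω
  exact (Literature.Probability.Percolation.BHK2006.ind_inter (U 0) (U 1) ω).symm

/-- (M⁺-k) holds for `k ≤ 2`. [this work] -/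
theorem masterFamilyCombPos_of_le_two {k : ℕ} (hk : k ≤ 2) : MasterFamilyCombPos k := by
  interval_cases k
  · exact masterFamilyCombPos_zero
  · exact masterFamilyCombPos_one
  · exact masterFamilyCombPos_two

end Summit.CriticalPhenomena.PercolationContinuityZ3.Theorems
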